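import Summits.CriticalPhenomena.PercolationContinuityZ3.Theorems.PercNearOneGluingNoHeavyQuantFarGate3PinchPData1
import Summits.CriticalPhenomena.PercolationContinuityZ3.Theorems.PercNearOneGluingNoHeavyQuantFarGate3PinchPData2
import Summits.CriticalPhenomena.PercolationContinuityZ3.Theorems.PercNearOneGluingNoHeavyQuantFarGate3PinchPData3
import Summits.CriticalPhenomena.PercolationContinuityZ3.Theorems.PercNearOneGluingNoHeavyQuantFarGate3PinchPData4
import HarnessLib

/-!
# QUANT lane R8, front "FAR beyond trees", layer one — THE DEGREE-THREE GATE AT THE OBSERVER: pinch chart P — MASTER theorem `pinchP_all`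

builds on p205010 (kernel theorem, internal audit signed; external expert review pending)

Support file (`--supports stmt-CriticalPhenomena-4575`), seats `prim-quant-p1` gen 35/36; memos
`run/shared/lean/prim/quant/prim-quant-p1-g35/FOR-LEAD-GATE3-PINCH.md`, `…/prim-quant-p1-g36/FOR-LEAD-GATE3-PINCH2.md`.  The 4 data files of chart P only; standard axioms; no sorries.
GENERATED by `dataN2/gen_master2.py`.

`pinchP_all`: chart P (`PinchP.spec`) has no bad point on the whole box `y ∈ [0, 1/8]`, `a ∈ [0, 1/3]`, `b ∈ [0, 1/3]`, `c ∈ [0, 1/3]`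
(5 kernel-checked certificates in 4 data files), by dispatch along the k-d tree of the file regions — the hypothesis `HP` of the pinch atlas
`Gate3.chartC_of_pinchAtlas` (file LXXII).
[this work].
-/

namespace Summit.CriticalPhenomena.PercolationContinuityZ3.Theorems

namespace Quant

set_option maxHeartbeats 800000 in
/-- Chart P has no bad point on its whole atlas box. [this work] -/
theorem pinchP_all : CertN.BoxOKR PinchP.spec (0 : ℝ) ((1 : ℝ) / 8) (0 : ℝ) ((1 : ℝ) / 3) (0 : ℝ) ((1 : ℝ) / 3) (0 : ℝ) ((1 : ℝ) / 3) := by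
  intro y a b c hylo hyhi halo hahi hblo hbhi hclo hchi v
  rcases le_total y ((1 : ℝ) / 32) with hcut | hcut
  · rcases le_total c ((1 : ℝ) / 6) with hcut | hcut
    · rcases le_total a ((1 : ℝ) / 6) with hcut | hcut
      · exact pinchP_d1 y a b c (by linarith) (by linarith) (by linarith) (by linarith) (by linarith) (by linarith) (by linarith) (by linarith) v
      · exact pinchP_d2 y a b c (by linarith) (by linarith) (by linarith) (by linarith) (by linarith) (by linarith) (by linarith) (by linarith) v
    · exact pinchP_d3 y a b c (by linarith) (by linarith) (by linarith) (by linarith) (by linarith) (by linarith) (by linarith) (by linarith) v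
  · exact pinchP_d4 y a b c (by linarith) (by linarith) (by linarith) (by linarith) (by linarith) (by linarith) (by linarith) (by linarith) v

end Quant

end Summit.CriticalPhenomena.PercolationContinuityZ3.Theorems
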